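import Summits.CriticalPhenomena.PercolationContinuityZ3.Theorems.PercNearOneGluingNoHeavyLowerTailAntitheticTwinAnchor
import HarnessLib

/-!
# `NoHeavyLowerTail` (stmt-CriticalPhenomena-4575) — antithetic cluster pairs: **THEOREM TW — THE TOP EVENT AT EVERY TWIN OF THE SOURCE**
# (CONJECTURE TW of HOME/THEOREM-T2.md / THEOREM-TW.md settled; prim-hp-2 gen 74, HOME/THEOREM-TWIN.md, HOME/MEMO-gen74.md)

Support file (`--supports stmt-CriticalPhenomena-4575`, hull-port prover `prim-hp-2`, gen 74).  No definitions, no named facts, no sorries;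
standard axioms.  Notation: colourings `T ⊆ Sym2 V`, `X T = openCluster (T ∩ E) s`, `Y T = openCluster (Tᶜ ∩ E) s`; `s ≠ P` are TWINS:
`sP ∉ E` and `N(s) ∖ P = N(P) ∖ s` (`htwin`); `K₁, K₂` super-odd twisted-monotone kernels (⊇ shifted class ⊇ odd class).

THEOREM TW (`Antithetic.Twin.top_sum_nonneg_twin`).  For EVERY finite graph and EVERY pair of non-adjacent twins `s, P` — no hypothesis on
the common neighbourhood or on the rest of the graph —
   `0 ≤ Σ_{T : P ∈ X T, P ∉ Y T} K₁(X T, Y T)·K₂(X T, Y T)`,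
hence TOP_shift(E; P) (`…top_shift_sum_nonneg_twin`) and the |R| = 1 VERTEX ANTITHETIC INEQUALITY at `P` (`…vertex_sum_nonneg_twin`):
   `0 ≤ Σ_{T : ¬(P ∈ X T ∧ P ∈ Y T)} (F(X T) − F(Y T))·(G(X T) − G(Y T))`   for all monotone `F, G`.
This contains THEOREMS TA, TC, TX, TP of gen 73 (complete multipartite graphs, `K_{m,n}`, suspensions, connected common neighbourhood, cut
hypothesis, sealed cuts) and settles every remaining twin shape (e.g. `N = {a, j}` non-adjacent with arbitrary further neighbours).
PROOF (HOME/THEOREM-TWIN.md).  Split the top event by the colours of the pairs at `s` and `P` towards the common neighbours: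
(1) some common neighbour red–red and some pair `sv` blue: nonnegative (`Twin.top_rr_br_sum_nonneg`, type boxes);
(2) ANCHOR BOXES: every pair `sv` red, `Pv` red exactly for `v ∈ R` (`R ≠ ∅`): there `Y T = {s}`, `P ∈ X T`, so the whole box lies in the top
event and contributes `Σ_box K₁(X T,{s}) K₂(X T,{s})`;
(3) no red–red common neighbour: such `T₀` has `R(T₀) := {v : Pv red} ≠ ∅`, all `sv` (`v ∈ R`) blue, and `T₀ ↦ T₀ ∪ {sv : v ∈ R(T₀)}` is a
bijection onto `{T ∈ box_R : T ∖ S_R ∈ top}` (`S_R = {sv : v ∈ R}`) which PRESERVES THE RED CLUSTER (`Twin.red_eq_of_anchor`).  So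
(2)+(3) = `Σ_R Σ_{T ∈ box_R} [K₁K₂(X T, {s}) + 𝟙[T ∖ S_R ∈ top]·K₁K₂(X T, Y(T ∖ S_R))]`.  On `box_R`, `T ↦ Y(T ∖ S_R)` is decreasing and
red-dominated (`Twin.dom_anchor`), `𝟙[T ∖ S_R ∈ top]` is increasing, so THEOREM W on the box (`PosPart.box_sum_ge`) bounds the second sum below
by `−Σ_box 𝟙·(K₁)₊(K₂)₊(X T, Y(T∖S_R))`, and `K(X T, {s}) ≥ (K(X T, Y(T∖S_R)))₊` (`Twin.kernel_anchor_ge_posPart`) pays for it.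
(Gen 73 reduced TW to CONJECTURE ST by discarding the anchor boxes as merely "≥ 0"; their mass is exactly what THEOREM W needs.)
[cite: VandenbergHaggstromKahn2005, §1 p. 6 ("Harris' inequality"), §1 p. 3 (open cluster `C_s`)]
-/

noncomputable section

namespace Summit.CriticalPhenomena.PercolationContinuityZ3.Theorems

open Literature.Probability.Percolation
open scoped Classical

namespace Antithetic

namespace Twin

variable {V : Type*} [Fintype V]

/-- **THEOREM TW (every twin pair, `K`-form).**  `s ≠ P` non-adjacent twins (`sP ∉ E`, `htwin`).  Then for all super-odd twisted-monotone
`K₁, K₂`:  `0 ≤ Σ_{T : P ∈ X T, P ∉ Y T} K₁(X T, Y T)·K₂(X T, Y T)`. [this work] -/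
theorem top_sum_nonneg_twin (E : Set (Sym2 V)) (s P : V) (hsP : s ≠ P) (hsPE : s(s, P) ∉ E)
    (htwin : ∀ v, v ≠ s → v ≠ P → (s(s, v) ∈ E ↔ s(P, v) ∈ E))
    {K₁ K₂ : Set V → Set V → ℝ}
    (hK₁ : ∀ ⦃A A' B B' : Set V⦄, A ⊆ A' → B' ⊆ B → K₁ A B ≤ K₁ A' B') (hso₁ : ∀ A B, 0 ≤ K₁ A B + K₁ B A)
    (hK₂ : ∀ ⦃A A' B B' : Set V⦄, A ⊆ A' → B' ⊆ B → K₂ A B ≤ K₂ A' B') (hso₂ : ∀ A B, 0 ≤ K₂ A B + K₂ B A) :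
    0 ≤ ∑ T ∈ Finset.univ.filter (fun T : Set (Sym2 V) => P ∈ openCluster (T ∩ E) s ∧ P ∉ openCluster (Tᶜ ∩ E) s),
      K₁ (openCluster (T ∩ E) s) (openCluster (Tᶜ ∩ E) s) * K₂ (openCluster (T ∩ E) s) (openCluster (Tᶜ ∩ E) s) := by
  -- notation
  let X : Set (Sym2 V) → Set V := fun T => openCluster (T ∩ E) s
  let Y : Set (Sym2 V) → Set V := fun T => openCluster (Tᶜ ∩ E) s
  let f : Set (Sym2 V) → ℝ := fun T => K₁ (X T) (Y T) * K₂ (X T) (Y T)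
  let top : Set (Sym2 V) → Prop := fun T => P ∈ X T ∧ P ∉ Y T
  let rr : Set (Sym2 V) → Prop := fun T => ∃ v, v ≠ s ∧ v ≠ P ∧ s(s, v) ∈ E ∧ s(s, v) ∈ T ∧ s(P, v) ∈ T
  let br : Set (Sym2 V) → Prop := fun T => ∃ v, v ≠ s ∧ v ≠ P ∧ s(s, v) ∈ E ∧ s(s, v) ∉ T
  let nbr : V → Prop := fun v => v ≠ s ∧ v ≠ P ∧ s(s, v) ∈ E
  show 0 ≤ ∑ T ∈ Finset.univ.filter top, f T
  have hXmono : Monotone X := fun T T' h => Freeze.openCluster_mono (Set.inter_subset_inter_left E h) s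
  have hYanti : Antitone Y := fun T T' h => Freeze.openCluster_mono (Set.inter_subset_inter_left E (Set.compl_subset_compl.2 h)) s
  have htop_mono : ∀ ⦃T T' : Set (Sym2 V)⦄, T ⊆ T' → top T → top T' :=
    fun T T' h hT => ⟨hXmono h hT.1, fun h' => hT.2 (hYanti h h')⟩
  -- (0) split the top event
  rw [← Finset.sum_filter_add_sum_filter_not _ rr, Finset.filter_filter, Finset.filter_filter]
  rw [← Finset.sum_filter_add_sum_filter_not (Finset.univ.filter fun T => top T ∧ rr T) br, Finset.filter_filter, Finset.filter_filter]
  -- (1) some red–red and some blue pair at `s`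
  have h1 : 0 ≤ ∑ T ∈ Finset.univ.filter (fun T => (top T ∧ rr T) ∧ br T), f T := by
    have h := top_rr_br_sum_nonneg E s P htwin hK₁ hso₁ hK₂ hso₂
    have he : Finset.univ.filter (fun T => (top T ∧ rr T) ∧ br T) =
        Finset.univ.filter (fun T : Set (Sym2 V) => P ∈ openCluster (T ∩ E) s ∧ P ∉ openCluster (Tᶜ ∩ E) s ∧
          (∃ v, v ≠ s ∧ v ≠ P ∧ s(s, v) ∈ E ∧ s(s, v) ∈ T ∧ s(P, v) ∈ T) ∧ (∃ v, v ≠ s ∧ v ≠ P ∧ s(s, v) ∈ E ∧ s(s, v) ∉ T)) := by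
      ext T
      simp only [Finset.mem_filter, Finset.mem_univ, true_and, top, rr, br, X, Y, and_assoc]
    rw [he]
    exact h
  rw [add_assoc]
  refine add_nonneg h1 ?_
  -- (2)+(3): fibre over `R(T) = {common neighbours v with Pv red}`
  let NB : Finset V := Finset.univ.filter nbr
  let Rfun : Set (Sym2 V) → Finset V := fun T => NB.filter fun v => s(P, v) ∈ T
  have hRmaps : ∀ T : Set (Sym2 V), Rfun T ∈ NB.powerset := fun T => Finset.mem_powerset.2 (Finset.filter_subset _ _)
  rw [← Finset.sum_fiberwise_of_maps_to (g := Rfun) (fun T _ => hRmaps T),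
    ← Finset.sum_fiberwise_of_maps_to (g := Rfun) (s := Finset.univ.filter fun T => top T ∧ ¬rr T) (fun T _ => hRmaps T),
    ← Finset.sum_add_distrib]
  refine Finset.sum_nonneg fun R hR => ?_
  have hRNB : R ⊆ NB := Finset.mem_powerset.1 hR
  have hRnbr : ∀ v ∈ R, nbr v := fun v hv => (Finset.mem_filter.1 (hRNB hv)).2
  -- the anchor box of `R` and the pulled-back colouring
  let boxR : Set (Sym2 V) → Prop := fun T => (∀ v, nbr v → s(s, v) ∈ T) ∧ (∀ v, nbr v → (s(P, v) ∈ T ↔ v ∈ R))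
  let SR : Set (Sym2 V) := {e | ∃ v ∈ (R : Set V), e = s(s, v)}
  have hSR : ∀ e ∈ SR, ∃ v, v ≠ s ∧ v ≠ P ∧ s(s, v) ∈ E ∧ e = s(s, v) := by
    rintro e ⟨v, hv, rfl⟩
    exact ⟨v, (hRnbr v hv).1, (hRnbr v hv).2.1, (hRnbr v hv).2.2, rfl⟩
  have hPnotSR : ∀ v, s(P, v) ∉ SR := by
    rintro v ⟨w, hw, he⟩
    rcases Sym2.eq_iff.1 he with ⟨h1, -⟩ | ⟨h1, -⟩
    · exact hsP h1.symm
    · exact (hRnbr w hw).2.1 h1.symm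
  -- case `R = ∅`: both fibres are empty
  by_cases hR0 : R = ∅
  · have e2 : (Finset.univ.filter fun T => (top T ∧ rr T) ∧ ¬br T).filter (fun T => Rfun T = R) = ∅ := by
      refine Finset.filter_eq_empty_iff.2 fun T hT hTR => ?_
      obtain ⟨⟨-, v, hvs, hvP, hvE, -, hPv⟩, -⟩ := (Finset.mem_filter.1 hT).2
      have : v ∈ Rfun T := Finset.mem_filter.2 ⟨Finset.mem_filter.2 ⟨Finset.mem_univ _, hvs, hvP, hvE⟩, hPv⟩
      rw [hTR, hR0] at this
      exact Finset.notMem_empty v this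
    have e3 : (Finset.univ.filter fun T => top T ∧ ¬rr T).filter (fun T => Rfun T = R) = ∅ := by
      refine Finset.filter_eq_empty_iff.2 fun T hT hTR => ?_
      obtain ⟨⟨hPX, -⟩, -⟩ := (Finset.mem_filter.1 hT).2
      obtain ⟨w, hwP, hwE, hwT⟩ := exists_red_pair_of_mem_red hsP hPX
      have hws : w ≠ s := fun h => hsPE (by rw [Sym2.eq_swap]; exact h ▸ hwE)
      have hwE' : s(s, w) ∈ E := (htwin w hws hwP).2 hwE
      have : w ∈ Rfun T := Finset.mem_filter.2 ⟨Finset.mem_filter.2 ⟨Finset.mem_univ _, hws, hwP, hwE'⟩, hwT⟩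
      rw [hTR, hR0] at this
      exact Finset.notMem_empty w this
    rw [e2, e3]
    simp
  obtain ⟨j, hj⟩ := Finset.nonempty_iff_ne_empty.2 hR0
  have hjn : nbr j := hRnbr j hj
  -- facts on the anchor box
  have hboxPX : ∀ T, boxR T → P ∈ X T := fun T hT =>
    mem_red_of_rr htwin hjn.1 hjn.2.1 hjn.2.2 (hT.1 j hjn) ((hT.2 j hjn).2 hj)
  have hboxY : ∀ T, boxR T → Y T = {s} := fun T hT =>
    blue_eq_singleton_of_red_at_source fun v hvs hvE =>
      hT.1 v ⟨hvs, fun h => hsPE (h ▸ hvE), hvE⟩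
  have hboxtop : ∀ T, boxR T → top T := fun T hT =>
    ⟨hboxPX T hT, by rw [hboxY T hT, Set.mem_singleton_iff]; exact fun h => hsP h.symm⟩
  -- (2) the anchor fibre is the anchor box
  have e2 : (Finset.univ.filter fun T => (top T ∧ rr T) ∧ ¬br T).filter (fun T => Rfun T = R) = Finset.univ.filter boxR := by
    ext T
    simp only [Finset.mem_filter, Finset.mem_univ, true_and]
    constructor
    · rintro ⟨⟨⟨-, -⟩, hnbr⟩, hTR⟩
      have hall : ∀ v, nbr v → s(s, v) ∈ T := fun v hv => by
        by_contra h
        exact hnbr ⟨v, hv.1, hv.2.1, hv.2.2, h⟩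
      refine ⟨hall, fun v hv => ?_⟩
      rw [← hTR]
      simp only [Rfun, NB, Finset.mem_filter, Finset.mem_univ, true_and]
      exact ⟨fun h => ⟨hv, h⟩, fun h => h.2⟩
    · intro hT
      refine ⟨⟨⟨hboxtop T hT, j, hjn.1, hjn.2.1, hjn.2.2, hT.1 j hjn, (hT.2 j hjn).2 hj⟩, ?_⟩, ?_⟩
      · rintro ⟨v, hvs, hvP, hvE, hv⟩
        exact hv (hT.1 v ⟨hvs, hvP, hvE⟩)
      · ext v
        simp only [Rfun, NB, Finset.mem_filter, Finset.mem_univ, true_and]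
        constructor
        · rintro ⟨hv, h⟩; exact (hT.2 v hv).1 h
        · intro h; exact ⟨hRnbr v h, (hT.2 v (hRnbr v h)).2 h⟩
  -- (3) the no-red–red fibre is the pull-back of the anchor box
  have e3 : ∑ T ∈ (Finset.univ.filter fun T => top T ∧ ¬rr T).filter (fun T => Rfun T = R), f T =
      ∑ T ∈ Finset.univ.filter boxR, (if top (T \ SR) then f (T \ SR) else 0) := by
    rw [← Finset.sum_filter]
    symm
    refine Finset.sum_nbij' (fun T => T \ SR) (fun T₀ => T₀ ∪ SR) ?_ ?_ ?_ ?_ ?_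
    · -- into
      intro T hT
      simp only [Finset.mem_filter, Finset.mem_univ, true_and] at hT ⊢
      obtain ⟨hbox, htop0⟩ := hT
      refine ⟨⟨htop0, ?_⟩, ?_⟩
      · rintro ⟨v, hvs, hvP, hvE, hsv, hPv⟩
        have hvR : v ∈ R := (hbox.2 v ⟨hvs, hvP, hvE⟩).1 hPv.1
        exact hsv.2 ⟨v, hvR, rfl⟩
      · ext v
        simp only [Rfun, NB, Finset.mem_filter, Finset.mem_univ, true_and, Set.mem_sdiff]
        constructor
        · rintro ⟨hv, hPv, -⟩; exact (hbox.2 v hv).1 hPv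
        · intro hv; exact ⟨hRnbr v hv, (hbox.2 v (hRnbr v hv)).2 hv, hPnotSR v⟩
    · -- back into
      intro T₀ hT₀
      simp only [Finset.mem_filter, Finset.mem_univ, true_and] at hT₀ ⊢
      obtain ⟨⟨htop0, hnrr⟩, hTR⟩ := hT₀
      have hdisj : ∀ e ∈ SR, e ∉ T₀ := by
        rintro e ⟨v, hv, rfl⟩ h
        have hvn : nbr v := hRnbr v hv
        have hPv : s(P, v) ∈ T₀ := by
          have hv' : v ∈ Rfun T₀ := by rw [hTR]; exact hv
          exact (Finset.mem_filter.1 hv').2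
        exact hnrr ⟨v, hvn.1, hvn.2.1, hvn.2.2, h, hPv⟩
      have hback : (T₀ ∪ SR) \ SR = T₀ := by
        ext e
        simp only [Set.mem_sdiff, Set.mem_union]
        constructor
        · rintro ⟨h | h, hn⟩
          · exact h
          · exact absurd h hn
        · intro h; exact ⟨Or.inl h, fun h' => hdisj e h' h⟩
      refine ⟨⟨fun v hv => ?_, fun v hv => ?_⟩, by rw [hback]; exact htop0⟩
      · by_cases hvR : v ∈ R
        · exact Or.inr ⟨v, hvR, rfl⟩
        · left
          have hPv : s(P, v) ∉ T₀ := fun h => hvR (by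
            rw [← hTR]; exact Finset.mem_filter.2 ⟨Finset.mem_filter.2 ⟨Finset.mem_univ _, hv⟩, h⟩)
          rcases noBB_of_top htwin htop0.2 hv.1 hv.2.1 hv.2.2 with h | h
          · exact h
          · exact absurd h hPv
      · simp only [Set.mem_union]
        constructor
        · rintro (h | h)
          · rw [← hTR]; exact Finset.mem_filter.2 ⟨Finset.mem_filter.2 ⟨Finset.mem_univ _, hv⟩, h⟩
          · exact absurd h (hPnotSR v)
        · intro hvR
          left
          rw [← hTR] at hvR
          exact (Finset.mem_filter.1 hvR).2
    · -- left inverse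
      intro T hT
      simp only [Finset.mem_filter, Finset.mem_univ, true_and] at hT
      ext e
      simp only [Set.mem_union, Set.mem_sdiff]
      constructor
      · rintro (⟨h, -⟩ | h)
        · exact h
        · obtain ⟨v, hv, rfl⟩ := h
          exact hT.1.1 v (hRnbr v hv)
      · intro h
        by_cases he : e ∈ SR
        · exact Or.inr he
        · exact Or.inl ⟨h, he⟩
    · -- right inverse
      intro T₀ hT₀
      simp only [Finset.mem_filter, Finset.mem_univ, true_and] at hT₀
      obtain ⟨⟨htop0, hnrr⟩, hTR⟩ := hT₀
      ext e
      simp only [Set.mem_sdiff, Set.mem_union]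
      constructor
      · rintro ⟨h | h, hn⟩
        · exact h
        · exact absurd h hn
      · intro h
        refine ⟨Or.inl h, ?_⟩
        rintro ⟨v, hv, rfl⟩
        have hvNB := hRNB hv
        rw [← hTR] at hv
        have hPv : s(P, v) ∈ T₀ := (Finset.mem_filter.1 hv).2
        exact hnrr ⟨v, (Finset.mem_filter.1 hvNB).2.1, (Finset.mem_filter.1 hvNB).2.2.1, (Finset.mem_filter.1 hvNB).2.2.2, h, hPv⟩
    · intro T hT; rfl
  rw [e2, e3, ← Finset.sum_add_distrib]
  -- (4) rewrite both summands on the box through `Wr = X`, `Wb T = Y (T ∖ SR)`, `u = 𝟙[top (T ∖ SR)]`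
  let Wb : Set (Sym2 V) → Set V := fun T => Y (T \ SR)
  let u : Set (Sym2 V) → ℝ := fun T => if top (T \ SR) then 1 else 0
  have hWb : Antitone Wb := fun T T' h => hYanti (Set.sdiff_subset_sdiff_left h)
  have hu0 : ∀ T, 0 ≤ u T := fun T => by simp only [u]; split_ifs <;> norm_num
  have hu1 : ∀ T, u T ≤ 1 := fun T => by simp only [u]; split_ifs <;> norm_num
  have hu : Monotone u := by
    intro T T' h
    simp only [u]
    by_cases hT : top (T \ SR)
    · rw [if_pos hT, if_pos (htop_mono (Set.sdiff_subset_sdiff_left h) hT)]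
    · rw [if_neg hT]; split_ifs <;> norm_num
  have hsWb : ∀ T, s ∈ Wb T := fun T => mem_openCluster_self _ s
  have hsX : ∀ T, s ∈ X T := fun T => mem_openCluster_self _ s
  have hterm : ∀ T ∈ Finset.univ.filter boxR,
      u T * (max (K₁ (X T) (Wb T)) 0 * max (K₂ (X T) (Wb T)) 0) + u T * (K₁ (X T) (Wb T) * K₂ (X T) (Wb T)) ≤
      f T + (if top (T \ SR) then f (T \ SR) else 0) := by
    intro T hT
    have hbox : boxR T := (Finset.mem_filter.1 hT).2
    -- the anchor term
    have hY : Y T = {s} := hboxY T hbox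
    have ha1 : max (K₁ (X T) (Wb T)) 0 ≤ K₁ (X T) {s} := kernel_anchor_ge_posPart hK₁ hso₁ (hsX T) (hsWb T)
    have ha2 : max (K₂ (X T) (Wb T)) 0 ≤ K₂ (X T) {s} := kernel_anchor_ge_posPart hK₂ hso₂ (hsX T) (hsWb T)
    have hfT : f T = K₁ (X T) {s} * K₂ (X T) {s} := by simp only [f]; rw [hY]
    have hanchor : u T * (max (K₁ (X T) (Wb T)) 0 * max (K₂ (X T) (Wb T)) 0) ≤ f T := by
      rw [hfT]
      have hm : max (K₁ (X T) (Wb T)) 0 * max (K₂ (X T) (Wb T)) 0 ≤ K₁ (X T) {s} * K₂ (X T) {s} :=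
        mul_le_mul ha1 ha2 (le_max_right _ _) ((le_max_right _ _).trans ha1)
      have hm0 : 0 ≤ max (K₁ (X T) (Wb T)) 0 * max (K₂ (X T) (Wb T)) 0 := mul_nonneg (le_max_right _ _) (le_max_right _ _)
      nlinarith [hu0 T, hu1 T]
    -- the pulled-back term
    have hpull : u T * (K₁ (X T) (Wb T) * K₂ (X T) (Wb T)) = (if top (T \ SR) then f (T \ SR) else 0) := by
      simp only [u]
      by_cases ht : top (T \ SR)
      · rw [if_pos ht, if_pos ht, one_mul]
        have hXeq : X T = X (T \ SR) :=
          red_eq_of_anchor htwin hSR Set.sdiff_subset (fun e he => by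
            by_cases h : e ∈ SR
            · exact Or.inr h
            · exact Or.inl ⟨he, h⟩) ht.1 ht.2
        simp only [f, Wb]
        rw [hXeq]
      · rw [if_neg ht, if_neg ht, zero_mul]
    linarith
  refine le_trans ?_ (Finset.sum_le_sum hterm)
  -- (5) THEOREM W on the anchor box
  let Fix : Set (Sym2 V) := {e | ∃ v, nbr v ∧ (e = s(s, v) ∨ e = s(P, v))}
  let Npat : Set (Sym2 V) := {e | ∃ v, nbr v ∧ (e = s(s, v) ∨ (e = s(P, v) ∧ v ∈ R))}
  -- membership of the two kinds of pairs in `Npat`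
  have hNs : ∀ v, nbr v → s(s, v) ∈ Npat := fun v hv => ⟨v, hv, Or.inl rfl⟩
  have hNP : ∀ v, nbr v → (s(P, v) ∈ Npat ↔ v ∈ R) := by
    intro v hv
    constructor
    · rintro ⟨w, hw, h | ⟨h, hwR⟩⟩
      · exfalso
        have : s ∈ s(P, v) := by rw [h]; exact Sym2.mem_mk_left s w
        rcases Sym2.mem_iff.1 this with h' | h'
        · exact hsP h'
        · exact hv.1 h'.symm
      · have : w ∈ s(P, v) := by rw [h]; exact Sym2.mem_mk_right P w
        rcases Sym2.mem_iff.1 this with h' | h'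
        · exact absurd h' hw.2.1
        · rw [← h']; exact hwR
    · intro hvR; exact ⟨v, hv, Or.inr ⟨rfl, hvR⟩⟩
  have hbox_iff : ∀ T : Set (Sym2 V), (∀ e ∈ Fix, (e ∈ T ↔ e ∈ Npat)) ↔ boxR T := by
    intro T
    constructor
    · intro h
      refine ⟨fun v hv => (h _ ⟨v, hv, Or.inl rfl⟩).2 (hNs v hv), fun v hv => ?_⟩
      rw [h _ ⟨v, hv, Or.inr rfl⟩]
      exact hNP v hv
    · rintro ⟨h1, h2⟩ e ⟨v, hv, he | he⟩
      · rw [he]; exact ⟨fun _ => hNs v hv, fun _ => h1 v hv⟩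
      · rw [he, h2 v hv, hNP v hv]
  have hD : ∀ T, T ∈ Finset.univ.filter boxR ↔ ∀ e ∈ Fix, (e ∈ T ↔ e ∈ Npat) := fun T => by
    rw [Finset.mem_filter, hbox_iff T]
    exact ⟨fun h => h.2, fun h => ⟨Finset.mem_univ _, h⟩⟩
  have hW := PosPart.box_sum_ge_of_mem Fix Npat (Finset.univ.filter boxR) hD X Wb hXmono hWb (fun T T' hT hT' hflip => ?_)
    hK₁ hso₁ hK₂ hso₂ hu0 hu
  · have hsplit : ∀ T : Set (Sym2 V), u T * (max (K₁ (X T) (Wb T)) 0 * max (K₂ (X T) (Wb T)) 0) + u T * (K₁ (X T) (Wb T) * K₂ (X T) (Wb T)) =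
        (u T * (K₁ (X T) (Wb T) * K₂ (X T) (Wb T)) -
          u T * (max (-K₁ (X T) (Wb T)) 0 * max (-K₂ (X T) (Wb T)) 0 - max (K₁ (X T) (Wb T)) 0 * max (K₂ (X T) (Wb T)) 0)) +
        u T * (max (-K₁ (X T) (Wb T)) 0 * max (-K₂ (X T) (Wb T)) 0) := fun T => by ring
    rw [Finset.sum_congr rfl fun T _ => hsplit T, Finset.sum_add_distrib, Finset.sum_sub_distrib]
    have hnn : 0 ≤ ∑ T ∈ Finset.univ.filter boxR, u T * (max (-K₁ (X T) (Wb T)) 0 * max (-K₂ (X T) (Wb T)) 0) :=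
      Finset.sum_nonneg fun T _ => mul_nonneg (hu0 T) (mul_nonneg (le_max_right _ _) (le_max_right _ _))
    exact add_nonneg (sub_nonneg.2 hW) hnn
  · -- red domination on the anchor box
    have hb : boxR T := (hbox_iff T).1 hT
    have hb' : boxR T' := (hbox_iff T').1 hT'
    refine dom_anchor hsP hsPE htwin (R := (R : Set V)) (fun v hv => hRnbr v hv) (j := j) hj
      (fun v hvs hvP hvE => hb.1 v ⟨hvs, hvP, hvE⟩) (fun v hvs hvP hvE => hb.2 v ⟨hvs, hvP, hvE⟩)
      (fun v hvs hvP hvE => hb'.1 v ⟨hvs, hvP, hvE⟩) (fun v hvs hvP hvE => hb'.2 v ⟨hvs, hvP, hvE⟩) fun e he => hflip e ?_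
    rintro ⟨v, hv, h | h⟩
    · exact he (Or.inl (by rw [h]; exact Sym2.mem_mk_left s v))
    · exact he (Or.inr (by rw [h]; exact Sym2.mem_mk_left P v))

/-- **THEOREM TW (shifted top form).**  `s ≠ P` non-adjacent twins.  Then TOP_shift(E; P): for all monotone `F⁻ ≤ F⁺`, `G⁻ ≤ G⁺`,
`0 ≤ Σ_{T : P ∈ X T, P ∉ Y T} (F⁺(X T) − F⁻(Y T))·(G⁺(X T) − G⁻(Y T))`. [this work] -/
theorem top_shift_sum_nonneg_twin (E : Set (Sym2 V)) (s P : V) (hsP : s ≠ P) (hsPE : s(s, P) ∉ E)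
    (htwin : ∀ v, v ≠ s → v ≠ P → (s(s, v) ∈ E ↔ s(P, v) ∈ E))
    (Fp Fm Gp Gm : Set V → ℝ) (hFp : Monotone Fp) (hFm : Monotone Fm) (hF : ∀ S, Fm S ≤ Fp S)
    (hGp : Monotone Gp) (hGm : Monotone Gm) (hG : ∀ S, Gm S ≤ Gp S) :
    0 ≤ ∑ T ∈ Finset.univ.filter (fun T : Set (Sym2 V) => P ∈ openCluster (T ∩ E) s ∧ P ∉ openCluster (Tᶜ ∩ E) s),
      (Fp (openCluster (T ∩ E) s) - Fm (openCluster (Tᶜ ∩ E) s)) * (Gp (openCluster (T ∩ E) s) - Gm (openCluster (Tᶜ ∩ E) s)) := by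
  have hK₁ : ∀ ⦃A A' B B' : Set V⦄, A ⊆ A' → B' ⊆ B → Fp A - Fm B ≤ Fp A' - Fm B' :=
    fun A A' B B' hA hB => sub_le_sub (hFp hA) (hFm hB)
  have hK₂ : ∀ ⦃A A' B B' : Set V⦄, A ⊆ A' → B' ⊆ B → Gp A - Gm B ≤ Gp A' - Gm B' :=
    fun A A' B B' hA hB => sub_le_sub (hGp hA) (hGm hB)
  have hso₁ : ∀ A B : Set V, 0 ≤ (Fp A - Fm B) + (Fp B - Fm A) := fun A B => by linarith [hF A, hF B]
  have hso₂ : ∀ A B : Set V, 0 ≤ (Gp A - Gm B) + (Gp B - Gm A) := fun A B => by linarith [hG A, hG B]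
  exact top_sum_nonneg_twin E s P hsP hsPE htwin (K₁ := fun A B => Fp A - Fm B) (K₂ := fun A B => Gp A - Gm B) hK₁ hso₁ hK₂ hso₂

/-- **THEOREM TW (the |R| = 1 vertex antithetic inequality at EVERY twin of the source).**  Let `s ≠ P` be non-adjacent twins
(`sP ∉ E`, `N(s) ∖ {P} = N(P) ∖ {s}`) in an arbitrary finite graph.  Then for all monotone `F, G`:
`0 ≤ Σ_{T : ¬(P ∈ X T ∧ P ∈ Y T)} (F(X T) − F(Y T))·(G(X T) − G(Y T))`. [this work] -/
theorem vertex_sum_nonneg_twin (E : Set (Sym2 V)) (s P : V) (hsP : s ≠ P) (hsPE : s(s, P) ∉ E)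
    (htwin : ∀ v, v ≠ s → v ≠ P → (s(s, v) ∈ E ↔ s(P, v) ∈ E))
    {F G : Set V → ℝ} (hF : Monotone F) (hG : Monotone G) :
    0 ≤ ∑ T ∈ Finset.univ.filter (fun T : Set (Sym2 V) =>
        ¬ ((openGraph (T ∩ E)).Reachable s P ∧ (openGraph (Tᶜ ∩ E)).Reachable s P)),
      (F (openCluster (T ∩ E) s) - F (openCluster (Tᶜ ∩ E) s)) * (G (openCluster (T ∩ E) s) - G (openCluster (Tᶜ ∩ E) s)) :=
  TopVertex.vertex_sum_nonneg_of_top E s P (fun F' G' hF' hG' =>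
    top_shift_sum_nonneg_twin E s P hsP hsPE htwin F' F' G' G' hF' hF' (fun _ => le_rfl) hG' hG' (fun _ => le_rfl)) hF hG

end Twin

end Antithetic

end Summit.CriticalPhenomena.PercolationContinuityZ3.Theorems
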